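import Mathlib.NumberTheory.LSeries.Deriv
import Literature.NumberTheory.Automorphic.RankinSelbergPNTDiagonal
import Literature.NumberTheory.Automorphic.PairLFunctionPolesEqConjLandau
import Literature.NumberTheory.Automorphic.PairLFunctionBoundaryMoeglinWaldspurger
import Literature.NumberTheory.Automorphic.PairLFunctionMeromorphicContinuationProofs
import Literature.NumberTheory.LFunctions.WienerIkeharaProofs
import HarnessLib

/-!
# The prime number theorem for `L^S(s, π ⊗ π̃)` (Liu–Ye 2007, Lemma 5.2): the printed proof,
# assembled on the tree's Rankin–Selberg inputs (proofs only)

Topic `NumberTheory/Automorphic`; namespace `Literature.NumberTheory.Automorphic`. Proof file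
(theorems only; it introduces no notion and no named fact), sibling of `RankinSelbergPNTDiagonal`
and its named fact `LiuYe2007_pnt_rankinSelberg_diag` — J. Liu, Y. Ye, *Perron's formula and the
prime number theorem for automorphic `L`-functions*, Pure Appl. Math. Q. **3** (2007), 481–497,
**Lemma 5.2** (p. 492): for a unitary cuspidal `π` on `GL_m` over `ℚ`, not necessarily
self-contragredient, `∑_{n ≤ x} Λ(n) |a_π(n)|² ∼ x`; in the tree's partial-sum rendering
`(1/x) ∑_{v ∉ S, q_v^k ≤ x, k ≥ 1} log q_v |∑_{a ∈ α v} a^k|² → 1`.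

## The printed proof (p. 492) and its formalization

"A Tauberian theorem of Ikehara says that, if `f(s) = ∑ a_n n^{-s}` (`σ > 1`) with `a_n ≥ 0`, and
if `g(s) = f(s) - 1/(s-1)` has analytic continuation to `σ ≥ 1`, then `∑_{n ≤ x} a_n ∼ x`. By RS1,
RS3, and RS5, we can apply this theorem to `f(s) = -L'/L(s, π × π̃)`." Here (pp. 487–488) RS1 is the
absolute convergence of the Euler product for `σ > 1` (Jacquet–Shalika), RS3 the continuation with
"the only poles … simple poles at `s = 0, 1`" (Jacquet–Shalika, Mœglin–Waldspurger) and RS5 the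
non-vanishing on `σ ≥ 1` (Shahidi). With `D(s) = L^S(s, π ⊗ π̄) = partialPairL S α ᾱ s`
(`π̃ ≅ π̄` for unitary `π`, `AutomorphicConjugate`; the Satake family of `π̄` is `ᾱ`,
`IsSatakeFamilyOf.conj`) the steps are:

* **RS1 and `D = exp Z` on `Re s > 1`** — PROVED in the tree (Jacquet–Shalika (1981), Thm. (5.3)):
  `partialPairL_conjFamily_eq_exp_LSeries_of_summable`, with `Z(s) = ∑_m a_m m^{-s}` the Dirichlet
  series (5.3.3) over `ℕ` (`normSqTraceSeries S α`, coefficients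
  `a_m = ∑_{q_v^k = m} |p_k(α v)|²/k ≥ 0`), absolutely convergent for `Re s > 1`
  (`summable_jsCoeff_mul_rpow_neg_of_isSatakeFamilyOf`, abscissa `≤ 1`).
* **`f = -D'/D = -Z'`** is the Dirichlet series with the non-negative coefficients `a_m log m =
  ∑_{q_v^k = m} log q_v |p_k(α v)|²` (Mathlib `LSeries_hasDerivAt`); its summatory function is
  the prime-power sum of the fact (`sum_Icc_log_mul_normSqTraceSeries_re`,
  `finsum_primePowerSum_eq_sum`: the exponents with `q_v^k ≤ N` are `1 ≤ k ≤ Nat.log q_v N`).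
* **RS3** is the tree's named fact `MoeglinWaldspurger1989_partialPairL_of_eq_conj`
  (`PairLFunctionMeromorphicContinuation`; Mœglin–Waldspurger (1989), Appendice, Cor. (ii)):
  `s (s - 1) D(s)` extends to an entire `G`. It is the ONE input not proved in the tree in rank
  `n ≥ 2` and enters here as a HYPOTHESIS (D-0026: not restated, not re-vendored); in rank `1` it
  is the theorem `MoeglinWaldspurger1989_partialPairL_of_eq_conj_one`. That the pole at `s = 1` is
  really there, `G(1) ≠ 0`, is PROVED in the tree from RS3 alone
  (`partialPairL_conjFamily_continuation_apply_one_ne_zero`, Landau's lemma and `|ω_π| = 1`).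
* **RS5 on the line `Re s = 1`, `s ≠ 1`** — the only use of Shahidi's theorem in the printed proof —
  is NOT taken from the (unproved) fact `JacquetShalika1981_partialPairL_boundary_of_ne_one`: for
  the *diagonal* pair `π ⊗ π̃` the coefficients of `log D` are non-negative, so de la Vallée
  Poussin's `3 + 4 cos θ + cos 2θ ≥ 0` gives `|D(σ)|³ |D(σ+it)|⁴ |D(σ+2it)| ≥ 1` and, with `G`
  entire, `G(1 + it) ≠ 0` for `t ≠ 0` — PROVED in the tree,
  `partialPairL_conj_continuation_ne_zero` (`PairLFunctionBoundaryMoeglinWaldspurger`). This is a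
  genuinely shorter road, recorded as a deviation from the printed citation of RS5; the
  continuation RS3 it uses is needed anyway.
* **Ikehara**: `g(s) = -D'/D(s) - 1/(s-1) = -G'(s)/G(s) + 1/s` is continuous on `Re s ≥ 1` (`G`
  has no zero there), so the Wiener–Ikehara theorem — PROVED in the tree,
  `LFunctions.WienerIkehara_holds` (Montgomery–Vaughan Cor. 8.8) — gives `∑_{m ≤ N} a_m log m =
  N + o(N)` (`sum_log_mul_sub_isLittleO_of_continuation`), and `⌊x⌋/x → 1` passes to real `x`
  (`tendsto_primePowerSum_div_of_continuation`).

Main results: `primePowerSum_sub_isLittleO_of_continuation` /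
`tendsto_primePowerSum_div_of_continuation` (every number field `K`, every rank `n ≥ 1`, from an
entire continuation of `s (s - 1) L^S(s, π ⊗ π̄)`);
`LiuYe2007_pnt_rankinSelberg_diag_of_moeglinWaldspurger` (**the named fact from
`MoeglinWaldspurger1989_partialPairL_of_eq_conj` and nothing else**); and, unconditionally,
`LiuYe2007_pnt_rankinSelberg_diag_one` (rank `1`: the prime number theorem for
`∑_{p ≤ x} log p |χ(p)|²`, `χ` a unitary Hecke character of `ℚ`). What remains for
`LiuYe2007_pnt_rankinSelberg_diag_holds` in rank `n ≥ 2` is exactly the discharge of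
`MoeglinWaldspurger1989_partialPairL_of_eq_conj` (the global Rankin–Selberg theory: continuation of
the mirabolic Eisenstein series, unfolding, local control at `S ∪ S_∞`).

## References

* J. Liu, Y. Ye, *Perron's formula and the prime number theorem for automorphic `L`-functions*,
  Pure Appl. Math. Q. 3 (2007), no. 2, 481–497: §4 RS1–RS5 (pp. 487–488), Lemma 5.2 and its proof
  (p. 492). [LiuYe2007]
* C. Mœglin, J.-L. Waldspurger, *Le spectre résiduel de `GL(n)`*, Ann. Sci. ÉNS (4) 22 (1989),
  Appendice, Corollaire (ii), p. 667. [MoeglinWaldspurger1989]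
* H. Jacquet, J. A. Shalika, *On Euler products and the classification of automorphic
  representations I*, Amer. J. Math. 103 (1981), Thm. (5.3) and its proof, p. 556.
  [JacquetShalikaAJM1981]
* H. L. Montgomery, R. C. Vaughan, *Multiplicative Number Theory I*, CUP (2007), Cor. 8.8
  (Wiener–Ikehara). [MontgomeryVaughan2007]
-/

noncomputable section

open scoped Topology ComplexOrder ComplexConjugate
open Filter Complex LSeries Asymptotics NumberField IsDedekindDomain MeasureTheory

namespace Literature.NumberTheory.Automorphic

open AdelicGroupData

/-! ### The logarithmic derivative and the Wiener–Ikehara step -/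

/-- **Ikehara's theorem applied to `-D'/D`** (the Tauberian step of Liu–Ye's Lemma 5.2). Let
`Z(s) = ∑ f(m) m^{-s}` have non-negative coefficients and abscissa of absolute convergence `≤ 1`,
and suppose `s (s - 1) exp Z(s)` (`Re s > 1`) extends to an entire function `G` with `G(1) ≠ 0`
(a simple pole of `D = exp Z` at `s = 1`: RS3) and `G(1 + iy) ≠ 0` for real `y ≠ 0` (no zero of
`D` on the line: RS5). Then `∑_{m ≤ N} f(m) log m = N + o(N)`: the Dirichlet series
`-D'/D = -Z' = ∑ f(m) log m · m^{-s}` has non-negative coefficients, converges for `Re s > 1`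
(RS1), and `-D'/D(s) - 1/(s - 1) = -G'(s)/G(s) + 1/s` on `Re s > 1` is continuous on `Re s ≥ 1`, so
the Wiener–Ikehara theorem (`LFunctions.WienerIkehara_holds`, proved in the tree) applies.
[cite: LiuYe2007, Lemma 5.2 (p. 492), proof] [cite: MontgomeryVaughan2007, Cor. 8.8] -/
theorem sum_log_mul_sub_isLittleO_of_continuation {f : ℕ → ℂ} (hf : 0 ≤ f)
    (habs : abscissaOfAbsConv f ≤ (1 : ℝ)) {G : ℂ → ℂ} (hG : Differentiable ℂ G)
    (hGeq : ∀ s : ℂ, 1 < s.re → G s = s * (s - 1) * cexp (LSeries f s)) (hG1 : G 1 ≠ 0)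
    (hGline : ∀ y : ℝ, y ≠ 0 → G (1 + I * y) ≠ 0) :
    (fun N : ℕ => ∑ m ∈ Finset.Icc 1 N, Real.log m * (f m).re - N) =o[atTop]
      fun N : ℕ => (N : ℝ) := by
  -- the coefficients `a_m = f(m) log m ≥ 0` of `-D'/D`
  set a : ℕ → ℝ := fun m => Real.log m * (f m).re with ha
  have hfm : ∀ m, f m = ((f m).re : ℂ) := fun m => by
    obtain ⟨-, him⟩ := Complex.nonneg_iff.mp (hf m)
    exact Complex.ext (by simp) (by simp [← him])
  have ha0 : ∀ m, 0 ≤ a m := fun m =>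
    mul_nonneg (Real.log_natCast_nonneg m) (Complex.nonneg_iff.mp (hf m)).1
  have haC : ∀ m, (a m : ℂ) = logMul f m := fun m => by
    rw [logMul, ← natCast_log, hfm m, ha]
    push_cast
    ring
  have haC' : (fun m => (a m : ℂ)) = logMul f := funext haC
  have habs' : ∀ s : ℂ, 1 < s.re → abscissaOfAbsConv f < s.re := fun s hs =>
    habs.trans_lt (by exact_mod_cast hs)
  -- `∑ a_m m^{-s}` converges for `Re s > 1`
  have hsum : ∀ s : ℂ, 1 < s.re → LSeriesSummable (fun m => (a m : ℂ)) s := fun s hs => by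
    rw [haC']
    exact LSeriesSummable_logMul_of_lt_re (habs' s hs)
  -- `G` has no zero on the closed half-plane `Re s ≥ 1`
  have hGne : ∀ s : ℂ, 1 ≤ s.re → G s ≠ 0 := by
    intro s hs
    rcases hs.eq_or_lt with h | h
    · have hs' : s = 1 + I * s.im := by
        apply Complex.ext <;> simp [← h]
      by_cases him : s.im = 0
      · rw [hs', him]
        simpa using hG1
      · rw [hs']
        exact hGline s.im him
    · rw [hGeq s h]
      have hs0 : s ≠ 0 := by
        rintro rfl
        simp at h
        linarith
      have hs1 : s - 1 ≠ 0 := by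
        intro h1
        rw [sub_eq_zero] at h1
        rw [h1] at h
        simp at h
      exact mul_ne_zero (mul_ne_zero hs0 hs1) (Complex.exp_ne_zero _)
  -- the continuous extension `r = -G'/G + 1/s` of `-D'/D - 1/(s-1)`
  set r : ℂ → ℂ := fun s => -(deriv G s / G s) + s⁻¹ with hr
  have hrc : ContinuousOn r {s : ℂ | 1 ≤ s.re} := by
    have hdc : Continuous (deriv G) := (hG.contDiff (n := 1)).continuous_deriv le_rfl
    refine ((hdc.continuousOn.div hG.continuous.continuousOn fun s hs => hGne s hs).neg).add
      (continuousOn_id.inv₀ fun s hs h0 => ?_)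
    have h1 : (1 : ℝ) ≤ s.re := hs
    rw [show s = 0 from h0, Complex.zero_re] at h1
    linarith
  have hreq : ∀ s : ℂ, 1 < s.re →
      r s = LSeries (fun m => (a m : ℂ)) s - ((1 : ℝ) : ℂ) / (s - 1) := by
    intro s hs
    have hs0 : s ≠ 0 := by
      rintro rfl
      simp at hs
      linarith
    have hs1 : s - 1 ≠ 0 := by
      intro h1
      rw [sub_eq_zero] at h1
      rw [h1] at hs
      simp at hs
    -- `G = s (s - 1) exp Z` near `s`, so `G'(s)` is computed from the right-hand side
    have hZ : HasDerivAt (LSeries f) (-LSeries (logMul f) s) s := LSeries_hasDerivAt (habs' s hs)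
    have hE : HasDerivAt (fun s : ℂ => s * (s - 1) * cexp (LSeries f s))
        ((1 * (s - 1) + s * 1) * cexp (LSeries f s) +
          s * (s - 1) * (cexp (LSeries f s) * -LSeries (logMul f) s)) s :=
      (((hasDerivAt_id s).mul ((hasDerivAt_id s).sub_const 1)).mul hZ.cexp)
    have hev : (fun s : ℂ => s * (s - 1) * cexp (LSeries f s)) =ᶠ[𝓝 s] G := by
      have ho : IsOpen {s : ℂ | 1 < s.re} := isOpen_lt continuous_const Complex.continuous_re
      filter_upwards [ho.mem_nhds hs] with w hw
      exact (hGeq w hw).symm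
    have hdG : deriv G s = (1 * (s - 1) + s * 1) * cexp (LSeries f s) +
        s * (s - 1) * (cexp (LSeries f s) * -LSeries (logMul f) s) :=
      (hE.congr_of_eventuallyEq hev.symm).deriv
    rw [haC', hr]
    dsimp only
    rw [hdG, hGeq s hs]
    have hexp : cexp (LSeries f s) ≠ 0 := Complex.exp_ne_zero _
    push_cast
    field_simp
    ring
  -- Wiener–Ikehara
  have hW := Literature.NumberTheory.LFunctions.WienerIkehara_holds a 1 ha0 hsum ⟨r, hrc, hreq⟩
  simpa only [one_mul] using hW

/-! ### Regrouping the coefficients of `-D'/D` by prime powers -/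

section Regroup

variable {ι : Type*}

/-- The set of indices of bounded norm `{i | N i ≤ M}` is finite when `N` has finite fibres.
[folklore] -/
theorem finite_setOf_apply_le {N : ι → ℕ} (hfin : ∀ m, (N ⁻¹' {m}).Finite) (M : ℕ) :
    {i : ι | N i ≤ M}.Finite := by
  have h : {i : ι | N i ≤ M} = ⋃ m ∈ Set.Iic M, N ⁻¹' {m} := by
    ext i
    simp
  rw [h]
  exact (Set.finite_Iic M).biUnion fun m _ => hfin m

/-- **Summatory function of the regrouped, `log`-weighted coefficients.** For `c : ι → ℝ` and
`N : ι → ℕ` with finite fibres and no value `0`: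
`∑_{1 ≤ m ≤ M} log m · (∑_{N i = m} c i) = ∑_{N i ≤ M} log (N i) · c i`. [folklore] -/
theorem sum_Icc_log_mul_tsum_fiber (c : ι → ℝ) {N : ι → ℕ} (hN : ∀ i, N i ≠ 0)
    (hfin : ∀ m, (N ⁻¹' {m}).Finite) (M : ℕ) :
    ∑ m ∈ Finset.Icc 1 M, Real.log m * ∑' i : N ⁻¹' {m}, c i =
      ∑ i ∈ (finite_setOf_apply_le hfin M).toFinset, Real.log (N i) * c i := by
  classical
  set F := (finite_setOf_apply_le hfin M).toFinset with hF
  rw [← Finset.sum_fiberwise_of_maps_to (s := F) (t := Finset.Icc 1 M) (g := N) ?_]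
  · refine Finset.sum_congr rfl fun m hm => ?_
    have hset : N ⁻¹' {m} = ↑(F.filter fun i => N i = m) := by
      ext i
      simp only [Set.mem_preimage, Set.mem_singleton_iff, Finset.coe_filter, hF,
        Set.Finite.mem_toFinset, Set.mem_setOf_eq]
      exact ⟨fun h => ⟨h ▸ (Finset.mem_Icc.mp hm).2, h⟩, fun h => h.2⟩
    rw [tsum_congr_set_coe c hset, Finset.tsum_subtype', Finset.mul_sum]
    refine Finset.sum_congr rfl fun i hi => ?_
    rw [(Finset.mem_filter.mp hi).2]
  · intro i hi
    simp only [hF, Set.Finite.mem_toFinset, Set.mem_setOf_eq] at hi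
    exact Finset.mem_Icc.mpr ⟨Nat.one_le_iff_ne_zero.mpr (hN i), hi⟩

end Regroup

/-! ### The prime-power sum of the fact, along the integers -/

section PrimePowers

variable {K : Type} [Field K] [NumberField K]

/-- `log (q_v^{k+1}) · |p_{k+1}(α v)|² / (k + 1) = log q_v · |p_{k+1}(α v)|²`: the `log`-weighted
coefficient of (5.3.3) at `(k, v)` is the von Mangoldt weight of the prime power `q_v^{k+1}` times
`|a_π(q_v^{k+1})|²`. [folklore] -/
theorem log_jsBase_mul_jsCoeff (S : Set (HeightOneSpectrum (𝓞 K))) (α : SatakeFamily K)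
    (i : ℕ × {v : HeightOneSpectrum (𝓞 K) // v ∉ S}) :
    Real.log (jsBase S i : ℝ) * jsCoeff S α i =
      Real.log (i.2.1.residueCard : ℝ) * ‖((α i.2.1).map (· ^ (i.1 + 1))).sum‖ ^ 2 := by
  rw [jsBase, jsCoeff, Nat.cast_pow, Real.log_pow]
  have h : (i.1 + 1 : ℝ) ≠ 0 := by positivity
  field_simp
  push_cast
  ring

/-- **The prime-power sum along the integers.** For a Satake family `α` off `S` and `M : ℕ`:
`∑_{v ∉ S, q_v ≤ M} ∑_{1 ≤ k ≤ log_{q_v} M} log q_v · |p_k(α v)|² =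
 ∑_{(k, v) : q_v^{k+1} ≤ M} log q_v · |p_{k+1}(α v)|²` (the exponents `k` with `q_v^k ≤ M` are
exactly `1 ≤ k ≤ Nat.log q_v M`). [folklore] -/
theorem finsum_primePowerSum_eq_sum (S : Set (HeightOneSpectrum (𝓞 K))) (α : SatakeFamily K)
    (M : ℕ) :
    ∑ᶠ v ∈ {v : HeightOneSpectrum (𝓞 K) | v ∉ S ∧ v.residueCard ≤ M},
        ∑ k ∈ Finset.Icc 1 (Nat.log v.residueCard M),
          Real.log (v.residueCard : ℝ) * ‖((α v).map (· ^ k)).sum‖ ^ 2 =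
      ∑ i ∈ (finite_setOf_apply_le (finite_fiber_jsBase S) M).toFinset,
        Real.log (i.2.1.residueCard : ℝ) * ‖((α i.2.1).map (· ^ (i.1 + 1))).sum‖ ^ 2 := by
  classical
  have hA : {v : HeightOneSpectrum (𝓞 K) | v ∉ S ∧ v.residueCard ≤ M}.Finite :=
    (finite_setOf_residueCard_le M).subset fun v hv => hv.2
  rw [finsum_mem_eq_finite_toFinset_sum _ hA, Finset.sum_sigma']
  refine Finset.sum_bij' (fun vk hvk => (vk.2 - 1, ⟨vk.1, ?_⟩)) (fun i _ => ⟨i.2.1, i.1 + 1⟩)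
    ?_ ?_ ?_ ?_ ?_
  · -- `v ∉ S` from membership
    have h := (Finset.mem_sigma.mp hvk).1
    rw [Set.Finite.mem_toFinset] at h
    exact h.1
  · -- `(k - 1, v)` has `q_v^k ≤ M`
    intro vk hvk
    obtain ⟨hv, hk⟩ := Finset.mem_sigma.mp hvk
    rw [Set.Finite.mem_toFinset] at hv
    obtain ⟨hk1, hk2⟩ := Finset.mem_Icc.mp hk
    have hM : M ≠ 0 := by
      rintro rfl
      rw [Nat.log_zero_right] at hk2
      omega
    simp only [Set.Finite.mem_toFinset, Set.mem_setOf_eq, jsBase, Nat.sub_add_cancel hk1]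
    exact Nat.pow_le_of_le_log hM hk2
  · -- `(v, k + 1)` is in the sigma set
    intro i hi
    rw [Set.Finite.mem_toFinset, Set.mem_setOf_eq, jsBase] at hi
    have hq : 1 < i.2.1.residueCard := i.2.1.one_lt_residueCard
    refine Finset.mem_sigma.mpr
      ⟨?_, Finset.mem_Icc.mpr ⟨Nat.succ_pos _, Nat.le_log_of_pow_le hq hi⟩⟩
    rw [Set.Finite.mem_toFinset]
    exact ⟨i.2.2, (Nat.le_self_pow (Nat.succ_ne_zero _) _).trans hi⟩
  · intro vk hvk
    obtain ⟨-, hk⟩ := Finset.mem_sigma.mp hvk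
    obtain ⟨hk1, -⟩ := Finset.mem_Icc.mp hk
    simp [Nat.sub_add_cancel hk1]
  · intro i hi
    simp
  · intro vk hvk
    obtain ⟨-, hk⟩ := Finset.mem_sigma.mp hvk
    obtain ⟨hk1, -⟩ := Finset.mem_Icc.mp hk
    simp [Nat.sub_add_cancel hk1]

/-- **`∑_{m ≤ M} a_m log m` is the prime-power sum**, `a = normSqTraceSeries S α` the Dirichlet
series (5.3.3):
`∑_{1 ≤ m ≤ M} log m · Re a_m = ∑_{v ∉ S, q_v ≤ M} ∑_{q_v^k ≤ M} log q_v |p_k(α v)|²`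
(`Λ(q_v^k) |a_π(q_v^k)|²` summed over the prime powers `q_v^k ≤ M` off `S`). [folklore] -/
theorem sum_Icc_log_mul_normSqTraceSeries_re (S : Set (HeightOneSpectrum (𝓞 K)))
    (α : SatakeFamily K) (M : ℕ) :
    ∑ m ∈ Finset.Icc 1 M, Real.log m * (normSqTraceSeries S α m).re =
      ∑ᶠ v ∈ {v : HeightOneSpectrum (𝓞 K) | v ∉ S ∧ v.residueCard ≤ M},
        ∑ k ∈ Finset.Icc 1 (Nat.log v.residueCard M),
          Real.log (v.residueCard : ℝ) * ‖((α v).map (· ^ k)).sum‖ ^ 2 := by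
  rw [finsum_primePowerSum_eq_sum]
  have h : ∀ m, (normSqTraceSeries S α m).re = ∑' i : (jsBase S) ⁻¹' {m}, jsCoeff S α i :=
    fun m => by simp [normSqTraceSeries, fiberCoeff]
  simp only [h]
  rw [sum_Icc_log_mul_tsum_fiber (jsCoeff S α) (jsBase_ne_zero S) (finite_fiber_jsBase S) M]
  exact Finset.sum_congr rfl fun i _ => log_jsBase_mul_jsCoeff S α i

end PrimePowers

/-! ### The prime number theorem for `L^S(s, π ⊗ π̃)` from the continuation of `s (s - 1) L^S` -/

section PNT

variable {n : ℕ} {K : Type} [Field K] [NumberField K]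
  {μ : Measure (gl n K).automorphicQuotient} [(gl n K).IsAutomorphicMeasure μ]

/-- **Liu–Ye's Lemma 5.2 from RS1 + RS3 (the printed proof, assembled).** Let `π` be a cuspidal
automorphic representation of `GL_n(𝔸_K)` (`n ≥ 1`, in `L²_cusp`, hence unitary) with Satake family
`α` off a finite `S`, and suppose `s (s - 1) L^S(s, π ⊗ π̄)` (`Re s > 1`) extends to an entire
function `G` (RS3: Jacquet–Shalika / Mœglin–Waldspurger). Then along the integers
`∑_{v ∉ S, q_v^k ≤ N} log q_v |p_k(α v)|² = N + o(N)`. Inputs: RS1 and `L^S = exp (∑ a_m m^{-s})`,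
`a_m ≥ 0`, on `Re s > 1` (`partialPairL_conjFamily_eq_exp_LSeries_of_summable`, Jacquet–Shalika
Thm. (5.3), proved in the tree); the pole at `s = 1` is present, `G(1) ≠ 0`
(`partialPairL_conjFamily_continuation_apply_one_ne_zero`, proved in the tree); RS5 on the line
in the form needed — no zero of `G` on `Re s = 1` — by de la Vallée Poussin's argument instead of
Shahidi's theorem (`partialPairL_conj_continuation_ne_zero` of
`PairLFunctionBoundaryMoeglinWaldspurger`, proved in the tree); and Ikehara's theorem
(`sum_log_mul_sub_isLittleO_of_continuation`).
[cite: LiuYe2007, Lemma 5.2 (p. 492)] -/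
theorem primePowerSum_sub_isLittleO_of_continuation (hn : 0 < n)
    (P : CuspidalAutomorphicRepGL n K μ) {S : Set (HeightOneSpectrum (𝓞 K))} (hS : S.Finite)
    {α : SatakeFamily K} (hα : IsSatakeFamilyOf P S α) {G : ℂ → ℂ} (hG : Differentiable ℂ G)
    (hGeq : ∀ s : ℂ, 1 < s.re → G s = s * (s - 1) * partialPairL S α (conjFamily α) s) :
    (fun N : ℕ => (∑ᶠ v ∈ {v : HeightOneSpectrum (𝓞 K) | v ∉ S ∧ v.residueCard ≤ N},
        ∑ k ∈ Finset.Icc 1 (Nat.log v.residueCard N),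
          Real.log (v.residueCard : ℝ) * ‖((α v).map (· ^ k)).sum‖ ^ 2) - N) =o[atTop]
      fun N : ℕ => (N : ℝ) := by
  have hb : ∀ v ∉ S, ∀ a ∈ α v, ‖a‖ ≤ Real.sqrt v.residueCard := fun v hv a ha =>
    norm_satakeParameter_le_sqrt_holds P hα hv ha
  have hsum : ∀ σ : ℝ, 1 < σ → Summable fun i => jsCoeff S α i * (jsBase S i : ℝ) ^ (-σ) :=
    fun σ hσ => summable_jsCoeff_mul_rpow_neg_of_isSatakeFamilyOf P hα hσ
  have habs : abscissaOfAbsConv (normSqTraceSeries S α) ≤ (1 : ℝ) :=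
    abscissaOfAbsConv_normSqTraceSeries_le_one_of_summable_jsCoeff hsum
  have hGeq' : ∀ s : ℂ, 1 < s.re →
      G s = s * (s - 1) * cexp (LSeries (normSqTraceSeries S α) s) := fun s hs => by
    rw [hGeq s hs, partialPairL_conjFamily_eq_exp_LSeries_of_summable hb hs (hsum _ hs)]
  have hG1 : G 1 ≠ 0 :=
    partialPairL_conjFamily_continuation_apply_one_ne_zero hn P hS hα hG hGeq
  have hGline : ∀ y : ℝ, y ≠ 0 → G (1 + I * y) ≠ 0 := fun y hy =>
    partialPairL_conj_continuation_ne_zero P hα hG hGeq hy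
  have h := sum_log_mul_sub_isLittleO_of_continuation (normSqTraceSeries_nonneg S α) habs hG
    hGeq' hG1 hGline
  simp only [sum_Icc_log_mul_normSqTraceSeries_re] at h
  exact h

/-- **The same along the reals, in the shape of the fact `LiuYe2007_pnt_rankinSelberg_diag`:**
`(1/x) ∑_{v ∉ S, q_v ≤ x} ∑_{1 ≤ k, q_v^k ≤ x} log q_v |p_k(α v)|² → 1` as `x → ∞` (the sum is
that at `N = ⌊x⌋`, and `⌊x⌋ / x → 1`). [cite: LiuYe2007, Lemma 5.2 (p. 492)] -/
theorem tendsto_primePowerSum_div_of_continuation (hn : 0 < n)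
    (P : CuspidalAutomorphicRepGL n K μ) {S : Set (HeightOneSpectrum (𝓞 K))} (hS : S.Finite)
    {α : SatakeFamily K} (hα : IsSatakeFamilyOf P S α) {G : ℂ → ℂ} (hG : Differentiable ℂ G)
    (hGeq : ∀ s : ℂ, 1 < s.re → G s = s * (s - 1) * partialPairL S α (conjFamily α) s) :
    Tendsto (fun x : ℝ =>
        (∑ᶠ v ∈ {v : HeightOneSpectrum (𝓞 K) | v ∉ S ∧ (v.residueCard : ℝ) ≤ x},
          ∑ k ∈ Finset.Icc 1 (Nat.log v.residueCard ⌊x⌋₊),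
            Real.log (v.residueCard : ℝ) * ‖((α v).map (· ^ k)).sum‖ ^ 2) / x)
      atTop (𝓝 1) := by
  -- the prime-power sum as a function of `N : ℕ`
  set T : ℕ → ℝ := fun N => ∑ᶠ v ∈ {v : HeightOneSpectrum (𝓞 K) | v ∉ S ∧ v.residueCard ≤ N},
    ∑ k ∈ Finset.Icc 1 (Nat.log v.residueCard N),
      Real.log (v.residueCard : ℝ) * ‖((α v).map (· ^ k)).sum‖ ^ 2 with hT
  have h1 : (fun N : ℕ => T N - N) =o[atTop] fun N : ℕ => (N : ℝ) :=
    primePowerSum_sub_isLittleO_of_continuation hn P hS hα hG hGeq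
  -- along `x ↦ ⌊x⌋₊`
  have h2 : (fun x : ℝ => T ⌊x⌋₊ - (⌊x⌋₊ : ℝ)) =o[atTop] fun x : ℝ => ((⌊x⌋₊ : ℕ) : ℝ) :=
    h1.comp_tendsto tendsto_nat_floor_atTop
  have h3 : (fun x : ℝ => ((⌊x⌋₊ : ℕ) : ℝ)) =O[atTop] fun x : ℝ => x := by
    refine IsBigO.of_bound' ?_
    filter_upwards [eventually_ge_atTop 0] with x hx
    rw [Real.norm_of_nonneg (Nat.cast_nonneg _), Real.norm_of_nonneg hx]
    exact Nat.floor_le hx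
  have h4 : (fun x : ℝ => (⌊x⌋₊ : ℝ) - x) =o[atTop] fun x : ℝ => x := by
    refine IsBigO.trans_isLittleO (g := fun _ => (1 : ℝ)) ?_ (isLittleO_const_id_atTop 1)
    refine IsBigO.of_bound' ?_
    filter_upwards [eventually_ge_atTop 0] with x hx
    rw [norm_one, Real.norm_eq_abs, abs_sub_comm, abs_of_nonneg (sub_nonneg.2 (Nat.floor_le hx))]
    linarith [Nat.sub_one_lt_floor x]
  have h5 : (fun x : ℝ => T ⌊x⌋₊ - x) =o[atTop] fun x : ℝ => x := by
    have h := (h2.trans_isBigO h3).add h4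
    refine h.congr' (Eventually.of_forall fun x => ?_) EventuallyEq.rfl
    ring
  -- the function of the statement is `T ⌊x⌋₊` for `x ≥ 0`
  have h6 : (fun x : ℝ =>
      ∑ᶠ v ∈ {v : HeightOneSpectrum (𝓞 K) | v ∉ S ∧ (v.residueCard : ℝ) ≤ x},
        ∑ k ∈ Finset.Icc 1 (Nat.log v.residueCard ⌊x⌋₊),
          Real.log (v.residueCard : ℝ) * ‖((α v).map (· ^ k)).sum‖ ^ 2) =ᶠ[atTop]
      fun x : ℝ => T ⌊x⌋₊ := by
    filter_upwards [eventually_ge_atTop 0] with x hx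
    simp only [hT, Set.mem_setOf_eq, Nat.le_floor_iff hx]
  have h7 : (fun x : ℝ => T ⌊x⌋₊) ~[atTop] fun x : ℝ => x := h5.isEquivalent
  have h8 := (isEquivalent_iff_tendsto_one (eventually_ne_atTop 0)).mp h7
  exact h8.congr' (by
    filter_upwards [h6] with x hx
    simp only [Pi.div_apply, hx])

end PNT

/-! ### The named fact from Mœglin–Waldspurger's continuation; rank one unconditionally -/

section Rat

variable {n : ℕ} {μ : Measure (gl n ℚ).automorphicQuotient} [(gl n ℚ).IsAutomorphicMeasure μ]

/-- **Liu–Ye 2007, Lemma 5.2, from RS3.** The named fact `LiuYe2007_pnt_rankinSelberg_diag` — the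
prime number theorem `(1/x) ∑_{v ∉ S, q_v^k ≤ x} log q_v |∑_{a ∈ α v} a^k|² → 1` for every unitary
cuspidal `π` on `GL_n(𝔸_ℚ)`, `n ≥ 1`, and every Satake family `α` of `π` off a finite `S` — follows
from the continuation fact `MoeglinWaldspurger1989_partialPairL_of_eq_conj` (RS3: `s (s - 1)
L^S(s, π ⊗ π̃)` is entire) by the printed argument (Ikehara's theorem for `-L'/L(s, π × π̃)`), the
other inputs RS1 (Jacquet–Shalika), the pole at `1`, the non-vanishing on `Re s = 1` and the
Tauberian theorem being theorems of the tree or of this file (module docstring). Applied with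
`σ = π̄ = P.conj` (`π = σ̄`: `CuspidalAutomorphicRepGL.conj_conj`) and `β = ᾱ`
(`IsSatakeFamilyOf.conj`). [cite: LiuYe2007, Lemma 5.2 (p. 492)]
[cite: MoeglinWaldspurger1989, Appendice, Corollaire (ii), p. 667] -/
theorem LiuYe2007_pnt_rankinSelberg_diag_of_moeglinWaldspurger
    (h : MoeglinWaldspurger1989_partialPairL_of_eq_conj (n := n) (K := ℚ) (μ := μ)) :
    LiuYe2007_pnt_rankinSelberg_diag (n := n) (μ := μ) := by
  intro hn P S hS α hα
  obtain ⟨G, hG, hGeq⟩ := h hn P P.conj P.conj_conj.symm hS hα hα.conj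
  exact tendsto_primePowerSum_div_of_continuation hn P hS hα hG hGeq

/-- **Liu–Ye 2007, Lemma 5.2 in rank one, unconditionally**: for a cuspidal automorphic
representation of `GL_1(𝔸_ℚ)` in `L²_cusp` (a unitary Hecke character `χ`, `|χ(p)| = 1` off `S`)
the fact is the prime number theorem `(1/x) ∑_{p ∉ S, p^k ≤ x} log p · |χ(p)^k|² → 1`, and RS3 is
the theorem `MoeglinWaldspurger1989_partialPairL_of_eq_conj_one` (`L^S(s, χ ⊗ χ̄) = ζ^S(s)`, Hecke).
[cite: LiuYe2007, Lemma 5.2 (p. 492)] -/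
theorem LiuYe2007_pnt_rankinSelberg_diag_one {μ : Measure (gl 1 ℚ).automorphicQuotient}
    [(gl 1 ℚ).IsAutomorphicMeasure μ] : LiuYe2007_pnt_rankinSelberg_diag (n := 1) (μ := μ) :=
  LiuYe2007_pnt_rankinSelberg_diag_of_moeglinWaldspurger
    MoeglinWaldspurger1989_partialPairL_of_eq_conj_one

end Rat

end Literature.NumberTheory.Automorphic

end
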